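import Literature.Topology.FourManifolds.DehnTwistFactorisation
import HarnessLib

/-!
# Hurwitz cycle systems of broken Lefschetz fibrations: the data `(c; c₁, …, c_k)` and their
# Hurwitz equivalence

Topic `Literature/Topology/FourManifolds`.  First tranche of the definition request of the route
`SblfDescent` (summit `SmoothPoincare4`: "Hurwitz cycle systems …, Hurwitz equivalence … on
systems"), written over the mapping-class vocabulary of `MappingClassGroup.lean`
(`Mod(P, ∂P) = π₀ Diff(P rel ∂P)`), `OrientedDehnTwist.lean` (twisting data `TwistCurve P o` and
the right-handed twist `t_c`) and `DehnTwistFactorisation.lean` (signed words, `monodromy`,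
`HurwitzStep`, `conjWord`).  Everything here is a definition or is PROVED; no named facts.

Source.  R. İ. Baykur, K. Hayano, *Broken Lefschetz fibrations and mapping class groups*, Geom.
Topol. Monogr. 19 (2015) 269–290 = arXiv:1410.5531 (read: §2.2, §3.1, §3.2).  §3.2: for a broken
Lefschetz fibration `f : X → S²` with non-empty round locus, a Hurwitz path system
`α, α₁, …, αₙ` in the higher-genus disc gives *"vanishing cycles `c₁, …, cₙ ⊂ Σ_g` of Lefschetz
singularities of `f`"* and *"a vanishing cycle `c ⊂ Σ_g` of indefinite folds. We denote by `W_f`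
a sequence of vanishing cycles `(c; c₁, …, cₙ)`"*; Lemma 3.3: *"The product `t_{cₙ} ⋯ t_{c₁}` is
contained in the kernel `Ker(Φ_c)`, where `t_{cᵢ}` is the right-handed Dehn twist along `cᵢ`"*;
Definition 3.5: *"A system `(c; c₁, …, cₙ)` of simple closed curves is called a Hurwitz cycle
system if it satisfies the condition `t_{cₙ} ⋯ t_{c₁} ∈ Ker(Φ_c)`"*; then the two modifications,
the *elementary transformation*
`(c; c₁, …, cᵢ, cᵢ₊₁, …, cₙ) ⟶ (c; c₁, …, cᵢ₊₁, t_{cᵢ₊₁}(cᵢ), …, cₙ)` and the *simultaneous action*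
by `h ∈ Map(Σ_g)`, `(c; c₁, …, cₙ) ⟶ (h(c); h(c₁), …, h(cₙ))`; Definition 3.6: *"Two Hurwitz cycle
systems are said to be equivalent if one can be obtained from the other by successive application
of elementary transformations, simultaneous actions, and their inverse."*  §2.2: `Map(Σ)` is
`π₀ Diff⁺(Σ)` (orientation-preserving, fixing `∂Σ` pointwise) with the product `T₁ · T₂ = T₁ ∘ T₂`
— the functional convention of the tree's `RelDiffeo` / `MappingClassGroup`.

## Content (over a surface `P`, model `𝓡∂ 2`, smooth orientation `o`; `k` Lefschetz cycles)

* `HurwitzCycleData P o k` — **the data `(c; c₁, …, c_k)`**: a twisting datum `c` (the vanishing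
  cycle of the indefinite fold) and `k` twisting data `c₁, …, c_k` (the Lefschetz vanishing cycles,
  in Hurwitz order).  This is Baykur–Hayano's "system of simple closed curves" WITHOUT the kernel
  condition of Def. 3.5 (see "Not here"), whence the name.
* `HurwitzCycleData.word W = [(c_k, +), …, (c₁, +)]` — the positive word of the Lefschetz cycles in
  the tree's convention (first letter leftmost, functional notation), i.e. in REVERSE Hurwitz
  order, so that **`HurwitzCycleData.mu W = monodromy W.word = t_{c_k} ⋯ t_{c₁}`** is
  Baykur–Hayano's product, the global monodromy of the higher side (`mu_eq_prod`).
* `HurwitzCycleData.conj g hg W = (g(c); g(c₁), …, g(c_k))` for `g ∈ Diff⁺(P rel ∂P)`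
  (`RelDiffeo.orientedSubgroup`), with `word (g · W) = (word W)_g` (`word_conj`),
  **`μ(g · W) = [g] μ(W) [g]⁻¹`** (`mu_conj`) and `t_{g(c)} = [g] t_c [g]⁻¹` (`twist_c_conj`),
  all PROVED.
* `HurwitzCycleData.Move` — the two modifications preceding Def. 3.6: `elementary` = a Hurwitz
  move or inverse Hurwitz move of the tree (`HurwitzStep`) on the Lefschetz word with `c`
  unchanged — on the word `[c_k, …, cᵢ₊₁, cᵢ, …, c₁]` the elementary transformation is exactly the
  tree's move `(x, y) ↦ (t_x(y), x)` at the adjacent pair `(x, y) = (cᵢ₊₁, cᵢ)`, and its inverse is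
  the tree's `(x, y) ↦ (y, t_y⁻¹(x))`; `simultaneous` = the simultaneous action by
  `g ∈ Diff⁺(P rel ∂P)`.
* `HurwitzCycleData.Equivalent` — **equivalence of systems** (Def. 3.6): the equivalence relation
  generated by the moves and their inverses (`Relation.ReflTransGen` of the symmetrised move
  relation), with `refl` / `symm` / `trans`; PROVED: a move, hence an equivalence, changes the PAIR
  `(t_c, μ)` by one common conjugation in `Mod(P, ∂P)` (`Move.exists_conj`,
  `Equivalent.exists_conj`; an elementary transformation fixes both, `HurwitzStep.monodromy_eq`)
  — the shape in which the kernel condition of Def. 3.5 will be seen to be invariant.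

## Design notes

* **Closed fibres.**  The vocabulary is stated for every surface `P` charted on the half-plane
  (`ChartedSpace (EuclideanHalfSpace 2) P`, `IsManifold (𝓡∂ 2) ∞ P`), with or without boundary.
  The fibre `Σ_g` of a broken Lefschetz fibration is CLOSED: a closed surface `F` charted on `ℝ²`
  (e.g. the genus-two surface of `exists_genusTwoSurface`, `ClosedOrientableSurfaces.lean`) is put
  in this model by the tree's `HalfSpaceCharted F` (`ClosedAsCobordism.lean`: every chart followed
  by `(t, u) ↦ (eᵗ, u)`; `HalfSpaceCharted.boundary_eq_empty`), for which `Diff(P rel ∂P) = Diff(P)`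
  and `MappingClassGroupRelBoundary (𝓡∂ 2) P = π₀ Diff(P)` is the EXTENDED mapping class group
  (design note of `MappingClassGroup.lean`).  Baykur–Hayano's `Map(Σ)` is its orientation-preserving
  part: accordingly the simultaneous action is by `g ∈ Diff⁺(P rel ∂P)` only (as the tree's
  `conjWord`), and `μ(W)`, a product of right-handed twists, is the class of an element of `Diff⁺`.
* **Data, not isotopy classes.**  As in `DehnTwistFactorisation.lean`, a cycle is a twisting datum
  (a curve WITH an oriented tubular neighbourhood) and the moves act on honest data, so that
  `t_{g(c)} = [g] t_c [g]⁻¹` and the behaviour of `μ` under moves hold on the nose.  Baykur–Hayano's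
  systems are tuples of simple closed curves up to isotopy and their simultaneous action is by
  mapping classes; the present relation descends to theirs along `datum ↦ core curve`
  (`TwistCurve.core`), and statements about fibrations quantify over representing data.  That
  `t_c` depends only on the isotopy class of the core (Farb–Margalit §3.1.1) is a theorem about
  `Mod(P, ∂P)`, not needed to define the calculus and not asserted here.
* The number `k` of Lefschetz cycles is a parameter of the type; both moves preserve it.

## Not here (deliberately)

* **The capping homomorphism `Φ_c : Map(Σ_g)(c) → Map(Σ_{g-1})`** (Baykur–Hayano §3.1: restrict a
  representative preserving `c` setwise to `Σ ∖ c`, cap the two new ends by discs, forget their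
  centres; Lemma 3.1 / 3.2: `Ker Φ_c` is generated by lifted point pushes, a `Δ`-twist `Δ_{c,β}`
  and `t_c`).  The tree constructs none of: the stabiliser `Map(Σ)(c)` of the isotopy class of a
  curve, cutting and capping of surfaces with the induced homomorphism on `π₀ Diff`, the forgetful
  homomorphism.  It is the next definition item of the request.
* Consequently **the kernel condition `t_{c_k} ⋯ t_{c₁} ∈ Ker Φ_c` of Def. 3.5** — the predicate
  "`W` is a Hurwitz cycle SYSTEM" on `HurwitzCycleData` — is not defined here, nor is its
  invariance under the moves (which needs `Φ_{g(c)} ∘ conj_{[g]} = conj ∘ Φ_c`).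
* **"`W` is a Hurwitz cycle system OF the fibration `f`"** (§3.2: an identification of a reference
  fibre with `P`, a Hurwitz path system, vanishing cycles by parallel transport along its paths;
  Lemma 3.3) needs an Ehresmann connection for `f` off its critical image and the transport
  diffeomorphisms between regular fibres, which the tree does not have for (broken) Lefschetz
  fibrations (`IsSimplifiedBrokenLefschetzFibration` is a predicate on maps `X → S²`).
* Remark 3.7's modification `(c; c₁, …, cₙ) ⟶ (t_{c₁}(c); c₂, …, cₙ, c₁)` is, loc. cit., a
  simultaneous action by `t_{c₁}` followed by inverse elementary transformations; it gets no
  constructor of its own.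

## References

* R. İ. Baykur, K. Hayano, *Broken Lefschetz fibrations and mapping class groups*, Geom. Topol.
  Monogr. 19 (2015) 269–290; arXiv:1410.5531: §2.2, §3.1 (Lemma 3.1, Lemma 3.2), §3.2 (Lemma 3.3,
  Def. 3.5, Def. 3.6, Rem. 3.7), Thm. 3.9, Rem. 3.10. [BaykurHayano2015]
* D. Auroux, *A stable classification of Lefschetz fibrations*, Geom. Topol. 9 (2005), §2 Def. 5
  (Hurwitz moves, global conjugation). [Auroux2005]
* B. Farb, D. Margalit, *A Primer on Mapping Class Groups*, PMS 49 (2012), §2.1, §3.1.1,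
  Fact 3.7. [FarbMargalit2012]
-/

open scoped Manifold ContDiff Topology
open Set Function

noncomputable section

namespace Literature.Topology.FourManifolds

section Surface

variable {P : Type*} [TopologicalSpace P] [T2Space P] [ChartedSpace (EuclideanHalfSpace 2) P]
  [IsManifold (𝓡∂ 2) ∞ P] {o : SmoothOrientation (𝓡∂ 2) P}

variable (P o) in
/-- **The data `(c; c₁, …, c_k)` of a Hurwitz cycle system** on the oriented surface `(P, o)`
(Baykur–Hayano 2015, §3.2 and Def. 3.5: "a system `(c; c₁, …, cₙ)` of simple closed curves" —
`c` the vanishing cycle of the indefinite folds, `c₁, …, cₙ` those of the Lefschetz singularities,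
read along a Hurwitz path system), as twisting data of the tree (`TwistCurve`: a curve in the
interior with an oriented tubular neighbourhood, along which one twists right-handedly).  The
kernel condition `t_{c_k} ⋯ t_{c₁} ∈ Ker Φ_c` that makes such data a Hurwitz cycle SYSTEM is not a
field (see the module docstring). [cite: BaykurHayano2015, Def. 3.5] -/
structure HurwitzCycleData (k : ℕ) where
  /-- the vanishing cycle `c` of the indefinite fold (the round vanishing cycle) -/
  c : TwistCurve P o
  /-- the Lefschetz vanishing cycles `c₁, …, c_k`, in Hurwitz order -/
  cs : Fin k → TwistCurve P o

namespace HurwitzCycleData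

variable {k : ℕ}

/-! ### The Lefschetz word and the higher-side monodromy `μ = t_{c_k} ⋯ t_{c₁}` -/

/-- **The Lefschetz word `[(c_k, +), …, (c₁, +)]`** of the data: the positive word on the Lefschetz
cycles in the tree's convention for `monodromy` (first letter leftmost in functional notation),
i.e. listed in REVERSE Hurwitz order, so that its monodromy is Baykur–Hayano's product
`t_{c_k} ⋯ t_{c₁}` (`mu`, `mu_eq_prod`). [cite: BaykurHayano2015, Lemma 3.3] -/
def word (W : HurwitzCycleData P o k) : List (Letter P o) :=
  positiveWord (List.ofFn W.cs).reverse

omit [T2Space P] in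
/-- The Lefschetz word has `k` letters. [folklore] -/
@[simp] theorem length_word (W : HurwitzCycleData P o k) : W.word.length = k := by
  simp [word, positiveWord]

omit [T2Space P] in
/-- The Lefschetz word is a positive word (all its letters are right-handed twists). [folklore] -/
theorem isPositiveWord_word (W : HurwitzCycleData P o k) : IsPositiveWord W.word :=
  isPositiveWord_positiveWord _

/-- **`μ(W) = t_{c_k} ⋯ t_{c₁} ∈ Mod(P, ∂P)`**, the monodromy of the Lefschetz word — for the
system of a broken Lefschetz fibration "the global monodromy of the higher side" (Baykur–Hayano,
proof of Lemma 3.3), the element required to lie in `Ker Φ_c` by Def. 3.5.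
[cite: BaykurHayano2015, Lemma 3.3] -/
def mu (W : HurwitzCycleData P o k) : MappingClassGroupRelBoundary (𝓡∂ 2) P :=
  monodromy W.word

/-- `μ(W)` is the monodromy of the Lefschetz word. [folklore] -/
theorem monodromy_word (W : HurwitzCycleData P o k) : monodromy W.word = W.mu := rfl

/-- **`μ(W)` is the product `t_{c_k} ⋯ t_{c₁}`** of the right-handed twists along the Lefschetz
cycles, last cycle leftmost (so `t_{c₁}` acts first). [cite: BaykurHayano2015, Lemma 3.3] -/
theorem mu_eq_prod (W : HurwitzCycleData P o k) :
    W.mu = (List.ofFn fun i => (W.cs i).twist).reverse.prod := by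
  simp only [mu, word, monodromy_positiveWord, List.map_reverse, List.map_ofFn]
  rfl

/-! ### Simultaneous action by `Diff⁺(P rel ∂P)` -/

/-- **Simultaneous action** of `g ∈ Diff⁺(P rel ∂P)` on the data:
`(c; c₁, …, c_k) ↦ (g(c); g(c₁), …, g(c_k))` (image data, `TwistCurve.mapRel`) — Baykur–Hayano's
second modification, "simultaneous action by `h ∈ Map(Σ_g)`", through the representative `g` of
`h`. [cite: BaykurHayano2015, Def. 3.6] -/
def conj (g : DiffRelBoundary (𝓡∂ 2) P)
    (hg : g ∈ RelDiffeo.orientedSubgroup ((𝓡∂ 2).boundary P) o) (W : HurwitzCycleData P o k) :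
    HurwitzCycleData P o k :=
  ⟨W.c.mapRel g hg, fun i => (W.cs i).mapRel g hg⟩

omit [T2Space P] in
/-- The round cycle of `g · W` is `g(c)`. [folklore] -/
@[simp] theorem conj_c (g : DiffRelBoundary (𝓡∂ 2) P)
    (hg : g ∈ RelDiffeo.orientedSubgroup ((𝓡∂ 2).boundary P) o) (W : HurwitzCycleData P o k) :
    (W.conj g hg).c = W.c.mapRel g hg := rfl

omit [T2Space P] in
/-- The Lefschetz cycles of `g · W` are the `g(cᵢ)`. [folklore] -/
@[simp] theorem conj_cs (g : DiffRelBoundary (𝓡∂ 2) P)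
    (hg : g ∈ RelDiffeo.orientedSubgroup ((𝓡∂ 2).boundary P) o) (W : HurwitzCycleData P o k)
    (i : Fin k) : (W.conj g hg).cs i = (W.cs i).mapRel g hg := rfl

omit [T2Space P] in
/-- **The Lefschetz word of `g · W` is the global conjugate `(word W)_g`** of the tree (`conjWord`:
every datum moved by `g`, signs kept). [cite: Auroux2005, §2 Def. 5] -/
theorem word_conj (g : DiffRelBoundary (𝓡∂ 2) P)
    (hg : g ∈ RelDiffeo.orientedSubgroup ((𝓡∂ 2).boundary P) o) (W : HurwitzCycleData P o k) :
    (W.conj g hg).word = conjWord g hg W.word := by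
  simp only [word, conj, conjWord, positiveWord, List.map_reverse, List.map_ofFn]
  rfl

/-- **`μ(g · W) = [g] · μ(W) · [g]⁻¹`**: the simultaneous action conjugates the higher-side
monodromy (`monodromy_conjWord`). [cite: BaykurHayano2015, Def. 3.6] -/
theorem mu_conj (g : DiffRelBoundary (𝓡∂ 2) P)
    (hg : g ∈ RelDiffeo.orientedSubgroup ((𝓡∂ 2).boundary P) o) (W : HurwitzCycleData P o k) :
    (W.conj g hg).mu =
      MappingClassGroup.mk _ _ _ g * W.mu * (MappingClassGroup.mk _ _ _ g)⁻¹ := by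
  rw [mu, mu, word_conj, monodromy_conjWord]

/-- **`t_{g(c)} = [g] · t_c · [g]⁻¹`** for the round cycle of `g · W` (Farb–Margalit Fact 3.7,
`TwistCurve.twist_mapRel`). [cite: FarbMargalit2012, Fact 3.7] -/
theorem twist_c_conj (g : DiffRelBoundary (𝓡∂ 2) P)
    (hg : g ∈ RelDiffeo.orientedSubgroup ((𝓡∂ 2).boundary P) o) (W : HurwitzCycleData P o k) :
    (W.conj g hg).c.twist =
      MappingClassGroup.mk _ _ _ g * W.c.twist * (MappingClassGroup.mk _ _ _ g)⁻¹ :=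
  W.c.twist_mapRel g hg

/-! ### The moves and Hurwitz equivalence of systems -/

/-- **The two modifications of Hurwitz cycle systems** (Baykur–Hayano 2015, before Def. 3.6):
* `elementary` — an *elementary transformation*
  `(c; c₁, …, cᵢ, cᵢ₊₁, …, c_k) ⟶ (c; c₁, …, cᵢ₊₁, t_{cᵢ₊₁}(cᵢ), …, c_k)` or its inverse: on the
  Lefschetz word `[c_k, …, cᵢ₊₁, cᵢ, …, c₁]` this is exactly one Hurwitz move of the tree,
  `(x, y) ↦ (t_x(y), x)` at the adjacent pair `(x, y) = (cᵢ₊₁, cᵢ)`, resp. one inverse Hurwitz move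
  `(x, y) ↦ (y, t_y⁻¹(x))` (`HurwitzStep`), the round cycle `c` being unchanged;
* `simultaneous` — the *simultaneous action* `(c; c₁, …, c_k) ⟶ (g(c); g(c₁), …, g(c_k))` by
  `g ∈ Diff⁺(P rel ∂P)` (`conj`).
[cite: BaykurHayano2015, Def. 3.6] -/
inductive Move : HurwitzCycleData P o k → HurwitzCycleData P o k → Prop
  /-- an elementary transformation or its inverse: a (possibly inverse) Hurwitz move on the
  Lefschetz word, the round cycle unchanged -/
  | elementary {W W' : HurwitzCycleData P o k} (hc : W'.c = W.c) (h : HurwitzStep W.word W'.word) :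
      Move W W'
  /-- the simultaneous action by `g ∈ Diff⁺(P rel ∂P)` -/
  | simultaneous (g : DiffRelBoundary (𝓡∂ 2) P)
      (hg : g ∈ RelDiffeo.orientedSubgroup ((𝓡∂ 2).boundary P) o) (W : HurwitzCycleData P o k) :
      Move W (W.conj g hg)

/-- **Equivalence of Hurwitz cycle systems** (Baykur–Hayano 2015, Def. 3.6: "one can be obtained
from the other by successive application of elementary transformations, simultaneous actions, and
their inverse"): the equivalence relation generated by the moves.
[cite: BaykurHayano2015, Def. 3.6] -/
def Equivalent : HurwitzCycleData P o k → HurwitzCycleData P o k → Prop :=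
  Relation.ReflTransGen fun W W' => Move W W' ∨ Move W' W

/-- Equivalence of systems is reflexive. [folklore] -/
theorem Equivalent.refl (W : HurwitzCycleData P o k) : Equivalent W W :=
  Relation.ReflTransGen.refl

/-- A move is an equivalence. [folklore] -/
theorem Move.equivalent {W W' : HurwitzCycleData P o k} (h : Move W W') : Equivalent W W' :=
  Relation.ReflTransGen.single (Or.inl h)

/-- The inverse of a move is an equivalence. [folklore] -/
theorem Move.equivalent_symm {W W' : HurwitzCycleData P o k} (h : Move W' W) : Equivalent W W' :=
  Relation.ReflTransGen.single (Or.inr h)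

/-- Equivalence of systems is symmetric. [folklore] -/
theorem Equivalent.symm {W W' : HurwitzCycleData P o k} (h : Equivalent W W') :
    Equivalent W' W := by
  unfold Equivalent at h ⊢
  induction h with
  | refl => exact Relation.ReflTransGen.refl
  | tail _ hbc ih => exact Relation.ReflTransGen.head hbc.symm ih

/-- Equivalence of systems is transitive. [folklore] -/
theorem Equivalent.trans {W W' W'' : HurwitzCycleData P o k} (h : Equivalent W W')
    (h' : Equivalent W' W'') : Equivalent W W'' :=
  Relation.ReflTransGen.trans h h'

/-- **A move changes the pair `(t_c, μ)` by one common conjugation** in `Mod(P, ∂P)`: an elementary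
transformation fixes `c` and preserves `μ` (Hurwitz moves preserve the monodromy,
`HurwitzStep.monodromy_eq`), the simultaneous action by `g` conjugates both by `[g]`
(`twist_c_conj`, `mu_conj`). [cite: BaykurHayano2015, Def. 3.6] -/
theorem Move.exists_conj {W W' : HurwitzCycleData P o k} (h : Move W W') :
    ∃ g : MappingClassGroupRelBoundary (𝓡∂ 2) P,
      W'.c.twist = g * W.c.twist * g⁻¹ ∧ W'.mu = g * W.mu * g⁻¹ := by
  cases h with
  | elementary hc h =>
    refine ⟨1, ?_, ?_⟩
    · rw [hc, one_mul, inv_one, mul_one]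
    · rw [mu, mu, h.monodromy_eq, one_mul, inv_one, mul_one]
  | simultaneous g hg W => exact ⟨_, W.twist_c_conj g hg, W.mu_conj g hg⟩

/-- **Equivalent systems have simultaneously conjugate round twists and monodromies**: if `W ∼ W'`
then `t_{c'} = γ t_c γ⁻¹` and `μ(W') = γ μ(W) γ⁻¹` for one `γ ∈ Mod(P, ∂P)`.
[cite: BaykurHayano2015, Def. 3.6] -/
theorem Equivalent.exists_conj {W W' : HurwitzCycleData P o k} (h : Equivalent W W') :
    ∃ g : MappingClassGroupRelBoundary (𝓡∂ 2) P,
      W'.c.twist = g * W.c.twist * g⁻¹ ∧ W'.mu = g * W.mu * g⁻¹ := by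
  unfold Equivalent at h
  induction h with
  | refl => exact ⟨1, by group, by group⟩
  | @tail U V _ hUV ih =>
    obtain ⟨g, hgc, hgμ⟩ := ih
    rcases hUV with hUV | hUV
    · obtain ⟨g', h1, h2⟩ := hUV.exists_conj
      exact ⟨g' * g, by rw [h1, hgc]; group, by rw [h2, hgμ]; group⟩
    · obtain ⟨g', h1, h2⟩ := hUV.exists_conj
      refine ⟨g'⁻¹ * g, ?_, ?_⟩
      · calc V.c.twist = g'⁻¹ * (g' * V.c.twist * g'⁻¹) * g' := by group
          _ = g'⁻¹ * (g * W.c.twist * g⁻¹) * g' := by rw [← h1, hgc]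
          _ = g'⁻¹ * g * W.c.twist * (g'⁻¹ * g)⁻¹ := by group
      · calc V.mu = g'⁻¹ * (g' * V.mu * g'⁻¹) * g' := by group
          _ = g'⁻¹ * (g * W.mu * g⁻¹) * g' := by rw [← h2, hgμ]
          _ = g'⁻¹ * g * W.mu * (g'⁻¹ * g)⁻¹ := by group

end HurwitzCycleData

end Surface

end Literature.Topology.FourManifolds

end
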